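import Summits.QuantumFields.GaugeBoot.ERowMerge
import HarnessLib

/-!
# Generic binding kit, ℕ-keyed (`BindN`): coded equality rows checked in the kernel over DIGIT CODES, any dimension

Cell `pub-gaugeboot` (HOME `run/shared/lean/pub/pub-gaugeboot/`), seat lean2 (binding engine; FANOUT-PLAN A126 (2) and sequels).
`Eqs/GLYZc1D4Kit(M)` checks a coded equality row of a certified problem file against its combination of literal theorem rows by
comparing canonical forms of rows keyed by WORDS (`Word 4`); in the kernel every label comparison walks two lists of steps.
This kit does the same comparison with rows keyed by the labels' DIGIT CODES (`ℕ`, one GMP comparison each): measured ≈ 3×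
less kernel time than the word-keyed merge check on the same rows (chunk 21 s → 10 s), on top of the `n log n` of `ERowMerge`.
It is generic in the dimension `d` (digit `2μ+1` = `+e_μ`, `2μ+2` = `−e_μ`, most significant first, `0` = the empty word; `d ≤ 4`)
and in the valuation `W : Word d → ℝ`, so one kit serves every family (`D = 3`: `W = Rung0D3.W β L`, `D = 4`: `Rung0D4.W β L`):
* data format: a coded row `CRow = terms × witness`, terms `t <code> <num> <den>`, witness entries `l <λ num> <λ den> <def id> <pos>`
  over a family's CODED literal theorem rows `litN : ℕ × ℕ → GRow ℕ` (terms `(code, c0, c1)`);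
* `wdg d` decodes a code to a word, `decW d` a coded row to a word-keyed row, `decRowQ d` an `ℕ`-keyed row to a word-keyed row;
* `cchkN litN β₀ c` — the kernel check: `GRow.mcanon` (keys compared as naturals) of the row `=` that of the evaluated combination;
* `rowVal_decW_eq_zero_of_cchkN` — SOUNDNESS for any `W`: if every decoded literal row vanishes under `W` at `β₀` and the check
  passes, the decoded row vanishes under `W` at `β₀` (via `ERowMerge.rowVal_eq_zero_of_mcanon_eq_lincomb` with the valuation
  `n ↦ W (wdg d n)` and `rowVal_decRowQ`).
Nothing here is a certificate replay; positivity blocks are not treated.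

HONEST FRAMING (page 1 of every file of this cell): certified bounds on lattice expectations at STATED coupling, gauge
group, dimension and torus size; NOT a mass gap, NOT a continuum limit, NOT a string tension, NOT large `N`; NOT
Yang–Mills-summit-bearing (barriers `FixedCouplingUltralocality`, `PerturbativeInvisibility`).
-/

noncomputable section

open Literature.MathematicalPhysics.QuantumFieldTheory

namespace Summit.QuantumFields.GaugeBoot.BindN

/-- The step with digit `r ∈ {1,…,2d}`: `2μ+1 ↦ +e_μ`, `2μ+2 ↦ −e_μ` (other digits wrap `mod d`). -/
def stepOfDigit (d : ℕ) [NeZero d] (r : ℕ) : Step d :=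
  if (r - 1) % 2 = 0 then .fwd ⟨(r - 1) / 2 % d, Nat.mod_lt _ (Nat.pos_of_neZero d)⟩
  else .bwd ⟨(r - 1) / 2 % d, Nat.mod_lt _ (Nat.pos_of_neZero d)⟩

/-- Decode a digit code to a word (decimal digits, most significant first; `0` = the empty word); fuelled. -/
def wdg (d : ℕ) [NeZero d] (n : ℕ) : Word d := go n 64 where
  /-- peel the least significant digit, `fuel` (= 64 ≥ any label length in the cell's files) bounds the recursion -/
  go : ℕ → ℕ → Word d
    | _, 0 => []
    | n, fuel + 1 => if n = 0 then [] else go (n / 10) fuel ++ [stepOfDigit d (n % 10)]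

/-- `wdg 3 1324` is the plaquette word in `D = 3`. -/
example : wdg 3 1324 = [.fwd 0, .fwd 1, .bwd 0, .bwd 1] := by decide

/-- Coded term constructor `(code, numerator, denominator)` (fixes the numeral types for fast elaboration). -/
def t (w : ℕ) (n : ℤ) (den : ℕ) : ℕ × ℤ × ℕ := (w, n, den)

/-- Coded witness entry `(λ numerator, λ denominator, literal def id, position)`. -/
def l (n : ℤ) (den i k : ℕ) : ℤ × ℕ × ℕ × ℕ := (n, den, i, k)

/-- Coded literal-row entry `(code, c0 num, c0 den, c1 num, c1 den)` ↦ `(code, c0, c1)` (coefficient `c0 + c1·β/8`). -/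
def e (w : ℕ) (n0 : ℤ) (d0 : ℕ) (n1 : ℤ) (d1 : ℕ) : ℕ × ℚ × ℚ := (w, (n0 : ℚ) / d0, (n1 : ℚ) / d1)

/-- A CODED equality row: its terms and its combination witness. -/
abbrev CRow : Type := List (ℕ × ℤ × ℕ) × List (ℤ × ℕ × ℕ × ℕ)

/-- The terms of a coded row as an `ℕ`-keyed row `(code, num/den, 0)`. -/
def decN (ts : List (ℕ × ℤ × ℕ)) : GRow ℕ := ts.map fun t => (t.1, (t.2.1 : ℚ) / t.2.2, 0)

/-- The terms of a coded row as a word-keyed row `(wdg code, num/den, 0)` in dimension `d`. -/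
def decW (d : ℕ) [NeZero d] (ts : List (ℕ × ℤ × ℕ)) : GRow (Word d) := ts.map fun t => (wdg d t.1, (t.2.1 : ℚ) / t.2.2, 0)

/-- Decode the keys of an `ℕ`-keyed row. -/
def decRowQ (d : ℕ) [NeZero d] (r : GRow ℕ) : GRow (Word d) := r.map fun t => (wdg d t.1, t.2)

/-- Decode the witness: `(λ num, λ den, def id, position)` ↦ `(λ, (def id, position))`. -/
def decIdx (ls : List (ℤ × ℕ × ℕ × ℕ)) : List (ℚ × ℕ × ℕ) := ls.map fun l => ((l.1 : ℚ) / l.2.1, l.2.2)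

/-- The combination named by the witness over a family's coded literal rows `litN`. -/
def comboN (litN : ℕ × ℕ → GRow ℕ) (idx : List (ℚ × ℕ × ℕ)) : List (ℚ × GRow ℕ) := idx.map fun q => (q.1, litN q.2)

/-- Comparison of digit codes (one natural-number comparison in the kernel). -/
def ltN (a b : ℕ) : Bool := decide (a < b)

/-- **The per-row kernel check at coupling `β₀`** over coded literal rows `litN`: the merge-sort canonical form (keys compared as
naturals) of the row equals that of its combination evaluated at `β_std = β₀`. -/
def cchkN (litN : ℕ × ℕ → GRow ℕ) (β₀ : ℚ) (c : CRow) : Bool :=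
  decide (GRow.mcanon ltN (decN c.1) = GRow.mcanon ltN (GRow.evalAt β₀ (GRow.lincomb (comboN litN (decIdx c.2)))))

variable {d : ℕ} [NeZero d] (β : ℝ) (W : Word d → ℝ)

/-- Valuation transport: an `ℕ`-keyed row under `n ↦ W (wdg d n)` has the value of its decoded row under `W`. -/
theorem rowVal_decRowQ (r : GRow ℕ) : rowVal β (fun n => W (wdg d n)) r = rowVal β W (decRowQ d r) := by
  induction r with
  | nil => simp [decRowQ]
  | cons t r ih => simp only [decRowQ, List.map_cons, rowVal_cons] at ih ⊢; rw [ih]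

omit [NeZero d] in
/-- `decW` is `decRowQ ∘ decN`. -/
theorem decRowQ_decN [NeZero d] (ts : List (ℕ × ℤ × ℕ)) : decRowQ d (decN ts) = decW d ts := by
  simp [decRowQ, decN, decW, List.map_map, Function.comp_def]

/-- **Soundness of the check, any valuation**: if every decoded literal row vanishes under `W` at `β₀` and the coded row `c`
passes `cchkN litN β₀`, then the decoded row of `c` vanishes under `W` at `β₀`. -/
theorem rowVal_decW_eq_zero_of_cchkN (litN : ℕ × ℕ → GRow ℕ) (β₀ : ℚ)
    (hlit : ∀ i, rowVal (β₀ : ℝ) W (decRowQ d (litN i)) = 0) (c : CRow) (h : cchkN litN β₀ c = true) :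
    rowVal (β₀ : ℝ) W (decW d c.1) = 0 := by
  have key := rowVal_eq_zero_of_mcanon_eq_lincomb ltN (fun n => W (wdg d n)) β₀ (decN c.1)
    (comboN litN (decIdx c.2)) (of_decide_eq_true h) (by
      intro p hp
      obtain ⟨q, _, rfl⟩ := List.mem_map.1 hp
      rw [rowVal_decRowQ]; exact hlit q.2)
  rwa [rowVal_decRowQ, decRowQ_decN] at key

/-- List form. -/
theorem rowVal_decW_eq_zero_of_all_cchkN (litN : ℕ × ℕ → GRow ℕ) (β₀ : ℚ)
    (hlit : ∀ i, rowVal (β₀ : ℝ) W (decRowQ d (litN i)) = 0) (E : List CRow) (h : E.all (cchkN litN β₀) = true) :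
    ∀ c ∈ E, rowVal (β₀ : ℝ) W (decW d c.1) = 0 :=
  fun c hc => rowVal_decW_eq_zero_of_cchkN W litN β₀ hlit c (List.all_eq_true.1 h c hc)

/-- Indexed form: row `j` of `E` (default: the empty row). -/
theorem rowVal_decW_getD_eq_zero_of_all_cchkN (litN : ℕ × ℕ → GRow ℕ) (β₀ : ℚ)
    (hlit : ∀ i, rowVal (β₀ : ℝ) W (decRowQ d (litN i)) = 0) (E : List CRow) (h : E.all (cchkN litN β₀) = true) (j : ℕ) :
    rowVal (β₀ : ℝ) W (decW d (E.getD j ([], [])).1) = 0 := by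
  by_cases hj : j < E.length
  · rw [List.getD_eq_getElem _ _ hj]
    exact rowVal_decW_eq_zero_of_all_cchkN W litN β₀ hlit E h _ (List.getElem_mem hj)
  · rw [List.getD_eq_default _ _ (Nat.le_of_not_lt hj)]
    simp [decW]

/-- A literal-row table vanishes under `W` as soon as each of its lists does (the shape in which families state `hlit`):
`litN (i, k) = (tables.getD i []).getD k []`. -/
theorem hlit_of_tables (tables : List (List (GRow ℕ)))
    (h : ∀ T ∈ tables, ∀ r ∈ T, rowVal β W (decRowQ d r) = 0) (i : ℕ × ℕ) :
    rowVal β W (decRowQ d ((tables.getD i.1 []).getD i.2 [])) = 0 := by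
  by_cases hi : i.1 < tables.length
  · rw [List.getD_eq_getElem _ _ hi]
    by_cases hk : i.2 < (tables[i.1]).length
    · rw [List.getD_eq_getElem _ _ hk]
      exact h _ (List.getElem_mem hi) _ (List.getElem_mem hk)
    · rw [List.getD_eq_default _ _ (Nat.le_of_not_lt hk)]; simp [decRowQ]
  · rw [List.getD_eq_default _ _ (Nat.le_of_not_lt hi), List.getD_nil]; simp [decRowQ]

end Summit.QuantumFields.GaugeBoot.BindN

end
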